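import Mathlib
import Summits.ValiantsHypothesis.ValiantsHypothesis.Theorems.DivisionGapPerMultiplesHardStubHostBlockProjection
import Literature.Computability.AlgebraicComplexity.ArithCircuitProofs
import Literature.Computability.AlgebraicComplexity.PermanentIrreducible

/-!
# `DivisionGap.PerMultiplesHard` (stmt-ValiantsHypothesis-5068), line `uncharged-face-walk`:
the MANY-PARTS block projection at a host (stub `stub_hostBlockParts`)

Let `G ⊆ [n]²` be a host and `per_G = Σ_{σ ⊆ G} x^{μ_σ}` its face permanent.  Let `h ≠ 0` be a
multiplier over `ℝ≥0` all of whose exponents have total degree `D`, and let `A` (rows) and `B`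
(columns) be read through bijections `eA : Fin a ≃ A`, `eB : Fin a ≃ B`.  A cell `(x, y)` is
BLOCK-DIAGONAL when `x ∈ A ↔ y ∈ B`.  Suppose `h` has SOME exponent living on block-diagonal
cells and `G` contains a block-diagonal permutation.  Then there is `q ≠ 0` on the `a`-board
whose exponents are exactly the `A × B`-parts, pulled back along `(eA, eB)`, of the
block-diagonal exponents of `h`, with

  `L⁺(per_{G'} · q) ≤ L⁺(per_G · h) + 1`,   `G' = {(x, y) : (eA x, eB y) ∈ G}`,

for the tree's monotone fan-in-two `complexity` over `ℝ≥0`.  This is the landed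
`HostBlockProjection.stub_hostBlockProjection` WITHOUT the single-part hypothesis: instead of
collapsing the top form of `h` to one monomial we keep `q := prj (top_w h)`.  All moves are free
over `ℝ≥0`:

1. TOP FORM for the indicator weight `w` of the block-diagonal cells (`topComponent_mul`,
   `complexity_topComponent_le`): `top_w per_G = Σ_{σ ⊆ G block-diagonal} x^{μ_σ}`
   (`HostBlockProjection.topComponent_facePer_eq`), and the exponents of `top_w h` are EXACTLY
   the block-diagonal exponents of `h` (their `w`-weight is the full degree `D`;
   `mem_support_topComponent_iff`).
2. ONE PROJECTION onto the `a`-board (`IsProjection.complexity_le_holds`): the cell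
   `(eA s, eB t)` goes to `X (s, t)`, every other cell to `1`.  Then
   `top_w per_G ↦ N · per_{G'}`, `N ≠ 0` (`HostBlockProjection.sum_aeval_prj_eq`, the fibre
   count) and `top_w h ↦ q`, whose support is the set of pulled-back block-diagonal exponents
   (`prj (c x^m) = c x^{pb m}`, and coefficients in `ℝ≥0` add without cancellation).
3. RESCALE by `N⁻¹` (`complexity_smul_le_holds`, one gate).

Log (stub-worker): written on the landed `HostBlockProjection` / `BlockProjection` /
`RowConcentration` / `TopComponentFree` API; playbook: none fit. [folklore]
-/

noncomputable section

open MvPolynomial Literature.Computability.AlgebraicComplexity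
open scoped NNReal BigOperators
open Summit.ValiantsHypothesis.ValiantsHypothesis.Theorems.ZeroOneTransfer.Negative
open Summit.ValiantsHypothesis.ValiantsHypothesis.Theorems.DivisionGap.PerMultiplesHard.RowConcentration
  (conc_of_mem_support_topComponent weight_indicator_add weight_indicator_eq_degree_iff)
open Summit.ValiantsHypothesis.ValiantsHypothesis.Theorems.DivisionGap.PerMultiplesHard.BlockProjection
  (aeval_prj_monomial)
open Summit.ValiantsHypothesis.ValiantsHypothesis.Theorems.DivisionGap.PerMultiplesHard.HostBlockProjection
  (topComponent_facePer_eq sum_aeval_prj_eq)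

namespace Summit.ValiantsHypothesis.ValiantsHypothesis.Theorems.DivisionGap.PerMultiplesHard.HostBlockParts

variable {n a : ℕ} {A B : Finset (Fin n)}

/-! ### The top component for an indicator weight of a degree-homogeneous polynomial -/

/-- **Support of the top `𝟙_P`-component.**  If every exponent of `h` has total degree `D` and
some exponent of `h` lives on `P`, then the exponents of `top_{𝟙_P} h` are exactly the exponents
of `h` living on `P` (their `𝟙_P`-weight is the full degree `D`). [folklore] -/
theorem mem_support_topComponent_iff {α : Type*} {h : MvPolynomial α ℝ≥0} {D : ℕ}
    (hdeg : ∀ d ∈ h.support, d.degree = D) (P : α → Prop) [DecidablePred P]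
    {d₀ : α →₀ ℕ} (hd₀ : d₀ ∈ h.support) (hconc : ∀ e ∈ d₀.support, P e) (d : α →₀ ℕ) :
    d ∈ (topComponent (fun e => if P e then 1 else 0) h).support ↔
      d ∈ h.support ∧ ∀ e ∈ d.support, P e := by
  refine ⟨fun hd => ⟨support_topComponent_subset _ h hd,
    conc_of_mem_support_topComponent hdeg P hd₀ hconc hd⟩, fun hd => ?_⟩
  obtain ⟨hdh, hP⟩ := hd
  have hw : Finsupp.weight (fun e => if P e then 1 else 0) d =
      weightedTotalDegree (fun e => if P e then 1 else 0) h := by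
    refine le_antisymm (le_weightedTotalDegree _ hdh) (Finset.sup_le fun d' hd' => ?_)
    calc Finsupp.weight (fun e => if P e then 1 else 0) d'
        ≤ d'.degree := le_of_le_of_eq (Nat.le_add_right _ _) (weight_indicator_add P d')
      _ = d.degree := by rw [hdeg d' hd', hdeg d hdh]
      _ = Finsupp.weight (fun e => if P e then 1 else 0) d :=
          ((weight_indicator_eq_degree_iff P d).2 hP).symm
  rw [mem_support_iff, coeff_topComponent, if_pos hw]
  exact mem_support_iff.1 hdh

/-! ### The image of a polynomial under the projection onto the `a`-board -/

section Projection

variable (eA : Fin a ≃ {x // x ∈ A}) (eB : Fin a ≃ {x // x ∈ B})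

/-- A pull-back `pb` of exponents of the `n`-board to the `a`-board along `(eA, eB)`
(`pb m (x, y) = m (eA x, eB y)`) exists. [folklore] -/
theorem exists_pb : ∃ pb : ((Fin n × Fin n) →₀ ℕ) → (Fin a × Fin a) →₀ ℕ,
    ∀ m x y, pb m (x, y) = m ((eA x : Fin n), (eB y : Fin n)) :=
  ⟨fun m => Finsupp.equivFunOnFinite.symm fun xy => m ((eA xy.1 : Fin n), (eB xy.2 : Fin n)),
    fun _ _ _ => rfl⟩

variable (pb : ((Fin n × Fin n) →₀ ℕ) → (Fin a × Fin a) →₀ ℕ)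
  (hpb : ∀ m x y, pb m (x, y) = m ((eA x : Fin n), (eB y : Fin n)))
include hpb

/-- `pb m = m'` iff `m'` reads `m` on `A × B` through `(eA, eB)`. [folklore] -/
theorem pb_eq_iff (m : (Fin n × Fin n) →₀ ℕ) (m' : (Fin a × Fin a) →₀ ℕ) :
    pb m = m' ↔ ∀ x y : Fin a, m' (x, y) = m ((eA x : Fin n), (eB y : Fin n)) := by
  refine ⟨fun h x y => by rw [← h, hpb], fun h => Finsupp.ext fun xy => ?_⟩
  obtain ⟨x, y⟩ := xy
  rw [hpb, h x y]

/-- **Image of a polynomial under the projection.**  A projection sending the cell `(eA s, eB t)`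
to `X (s, t)` and every cell off `A × B` to `1` maps `p = Σ_m c_m x^m` to `Σ_m c_m x^{pb m}`.
[folklore] -/
theorem aeval_prj_eq_sum (prj : Fin n × Fin n → MvPolynomial (Fin a × Fin a) ℝ≥0)
    (hpX : ∀ s t, prj ((eA s : Fin n), (eB t : Fin n)) = X (s, t))
    (hp1 : ∀ e : Fin n × Fin n, ¬ (e.1 ∈ A ∧ e.2 ∈ B) → prj e = 1)
    (p : MvPolynomial (Fin n × Fin n) ℝ≥0) :
    aeval prj p = ∑ d ∈ p.support, monomial (pb d) (coeff d p) := by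
  conv_lhs => rw [p.as_sum]
  rw [map_sum]
  refine Finset.sum_congr rfl fun d _ => ?_
  rw [aeval_prj_monomial eA eB prj hpX hp1 (fun s t => (hpb d s t).symm) _,
    C_mul_monomial, mul_one]

/-- **Support of the image (no cancellation over `ℝ≥0`).**  The exponents of `prj p` are exactly
the pull-backs of the exponents of `p`. [folklore] -/
theorem mem_support_aeval_prj_iff (prj : Fin n × Fin n → MvPolynomial (Fin a × Fin a) ℝ≥0)
    (hpX : ∀ s t, prj ((eA s : Fin n), (eB t : Fin n)) = X (s, t))
    (hp1 : ∀ e : Fin n × Fin n, ¬ (e.1 ∈ A ∧ e.2 ∈ B) → prj e = 1)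
    (p : MvPolynomial (Fin n × Fin n) ℝ≥0) (m' : (Fin a × Fin a) →₀ ℕ) :
    m' ∈ (aeval prj p).support ↔ ∃ d ∈ p.support, pb d = m' := by
  classical
  rw [mem_support_iff, aeval_prj_eq_sum eA eB pb hpb prj hpX hp1 p, coeff_sum]
  constructor
  · intro hne
    obtain ⟨d, hd, hne⟩ := Finset.exists_ne_zero_of_sum_ne_zero hne
    rw [coeff_monomial] at hne
    exact ⟨d, hd, of_not_not fun h => hne (if_neg h)⟩
  · rintro ⟨d, hd, rfl⟩ h0
    have h1 := (Finset.sum_eq_zero_iff.1 h0) d hd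
    rw [coeff_monomial, if_pos rfl] at h1
    exact (mem_support_iff.1 hd) h1

end Projection

/-! ### The complexity step -/

/-- **Top form, projection, rescaling.**  If `prj` is a projection (every variable goes to a
variable or a constant) with `prj (top_w f) = N · g`, `N ≠ 0`, then
`L(g · prj (top_w h)) ≤ L(f · h) + 1`: `g · prj (top_w h) = N⁻¹ · prj (top_w (f · h))` by
`topComponent_mul`, the top form and the projection are free (`complexity_topComponent_le`,
`IsProjection.complexity_le_holds`) and the rescaling costs one gate
(`complexity_smul_le_holds`). [folklore] -/
theorem complexity_mul_aeval_topComponent_le {τ : Type*} (w : Fin n × Fin n → ℕ)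
    (prj : Fin n × Fin n → MvPolynomial τ ℝ≥0) (hpP : ∀ e, (∃ v, prj e = X v) ∨ ∃ c, prj e = C c)
    (f h : MvPolynomial (Fin n × Fin n) ℝ≥0) (g : MvPolynomial τ ℝ≥0) {N : ℝ≥0} (hN : N ≠ 0)
    (hS : aeval prj (topComponent w f) = N • g) :
    complexity (g * aeval prj (topComponent w h)) ≤ complexity (f * h) + 1 := by
  have hid : g * aeval prj (topComponent w h) = N⁻¹ • aeval prj (topComponent w (f * h)) := by
    rw [topComponent_mul, map_mul, hS, smul_mul_assoc, inv_smul_smul₀ hN]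
  have h1 : complexity (aeval prj (topComponent w (f * h))) ≤
      complexity (topComponent w (f * h)) :=
    IsProjection.complexity_le_holds ⟨prj, hpP, rfl⟩
  have h2 := complexity_topComponent_le w (f * h)
  have h3 := complexity_smul_le_holds N⁻¹ (aeval prj (topComponent w (f * h)))
  rw [hid]
  omega

/-! ### The stub -/

/-- **Many-parts block projection at a host (stub `stub_hostBlockParts` of line
`uncharged-face-walk`).**  If `h ≠ 0` is homogeneous in total degree, some exponent of `h` lives
on the block-diagonal cells of `(A, B)` (`#A = #B = a`, read through `eA`, `eB`), and the host `G`
contains a block-diagonal permutation, then there is `q ≠ 0` on the `a`-board whose exponents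
are exactly the `A × B`-parts (pulled back along `(eA, eB)`) of the block-diagonal exponents of
`h`, with `L⁺(per_{G'} · q) ≤ L⁺(per_G · h) + 1` for the induced host
`G' = {(x, y) : (eA x, eB y) ∈ G}`: `q := prj (top_w h)` for the block-diagonal indicator weight
`w` and the projection `prj` onto the `a`-board; one free top form, one free projection
(`top_w per_G ↦ N · per_{G'}`, `N ≠ 0`, by the fibre count), one rescaling gate. [folklore] -/
theorem stub_hostBlockParts :
    ∀ (n : ℕ) (G : Finset (Fin n × Fin n)) (h : MvPolynomial (Fin n × Fin n) ℝ≥0), h ≠ 0 →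
      ∀ (D : ℕ), (∀ d ∈ h.support, d.degree = D) →
      ∀ (A B : Finset (Fin n)) (a : ℕ) (eA : Fin a ≃ {x // x ∈ A}) (eB : Fin a ≃ {x // x ∈ B}),
        (∃ m ∈ h.support, ∀ e ∈ m.support, (e.1 ∈ A ↔ e.2 ∈ B)) →
        (∃ σ : Equiv.Perm (Fin n), (∀ i, (σ i, i) ∈ G) ∧ ∀ i, σ i ∈ A ↔ i ∈ B) →
        ∃ q : MvPolynomial (Fin a × Fin a) ℝ≥0, q ≠ 0 ∧
          (∀ m' : (Fin a × Fin a) →₀ ℕ, m' ∈ q.support ↔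
            ∃ m ∈ h.support, (∀ e ∈ m.support, (e.1 ∈ A ↔ e.2 ∈ B)) ∧
              ∀ x y : Fin a, m' (x, y) = m ((eA x : Fin n), (eB y : Fin n))) ∧
          complexity ((∑ σ ∈ (Finset.univ : Finset (Equiv.Perm (Fin a))).filter
                (fun σ => ∀ i, (((eA (σ i) : Fin n), (eB i : Fin n)) ∈ G)),
                monomial (permMonomial σ) (1 : ℝ≥0)) * q) ≤
            complexity ((∑ σ ∈ (Finset.univ : Finset (Equiv.Perm (Fin n))).filter (fun σ => ∀ i, (σ i, i) ∈ G),
              monomial (permMonomial σ) (1 : ℝ≥0)) * h) + 1 := by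
  intro n G h hh D hdeg A B a eA eB hex hG
  classical
  obtain ⟨m₀, hm₀, hm₀c⟩ := hex
  obtain ⟨σ₀, hσ₀G, hσ₀⟩ := hG
  set perG : MvPolynomial (Fin n × Fin n) ℝ≥0 :=
    ∑ σ ∈ (Finset.univ : Finset (Equiv.Perm (Fin n))).filter (fun σ => ∀ i, (σ i, i) ∈ G),
      monomial (permMonomial σ) (1 : ℝ≥0) with hperG
  set perG' : MvPolynomial (Fin a × Fin a) ℝ≥0 :=
    ∑ σ ∈ (Finset.univ : Finset (Equiv.Perm (Fin a))).filter
      (fun σ => ∀ i, (((eA (σ i) : Fin n), (eB i : Fin n)) ∈ G)),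
      monomial (permMonomial σ) (1 : ℝ≥0) with hperG'
  -- the projection, by specification
  obtain ⟨prj, hpX, hp1, hpP⟩ : ∃ prj : Fin n × Fin n → MvPolynomial (Fin a × Fin a) ℝ≥0,
      (∀ s t, prj ((eA s : Fin n), (eB t : Fin n)) = X (s, t)) ∧
      (∀ e : Fin n × Fin n, ¬ (e.1 ∈ A ∧ e.2 ∈ B) → prj e = 1) ∧
      ∀ e, (∃ v, prj e = X v) ∨ ∃ c, prj e = C c := by
    refine ⟨fun e => if hx : e.1 ∈ A ∧ e.2 ∈ B then
      X (eA.symm ⟨e.1, hx.1⟩, eB.symm ⟨e.2, hx.2⟩) else 1, fun s t => ?_, fun e he => dif_neg he,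
      fun e => ?_⟩
    · dsimp only
      rw [dif_pos ⟨(eA s).2, (eB t).2⟩]
      simp
    · dsimp only
      by_cases he : e.1 ∈ A ∧ e.2 ∈ B
      · exact Or.inl ⟨_, dif_pos he⟩
      · exact Or.inr ⟨1, by rw [dif_neg he, C_1]⟩
  -- (1) the weight: top forms
  set w : Fin n × Fin n → ℕ := fun e => if (e.1 ∈ A ↔ e.2 ∈ B) then 1 else 0 with hw
  have hsuppT : ∀ d, d ∈ (topComponent w h).support ↔
      d ∈ h.support ∧ ∀ e ∈ d.support, (e.1 ∈ A ↔ e.2 ∈ B) := fun d =>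
    mem_support_topComponent_iff hdeg (fun e => (e.1 ∈ A ↔ e.2 ∈ B)) hm₀ hm₀c d
  have htopP : topComponent w perG = ∑ σ ∈ (Finset.univ : Finset (Equiv.Perm (Fin n))).filter
      (fun σ => (∀ i, (σ i, i) ∈ G) ∧ ∀ i, (σ i ∈ A ↔ i ∈ B)),
        monomial (permMonomial σ) (1 : ℝ≥0) :=
    topComponent_facePer_eq A B G hσ₀G hσ₀
  -- (2) the images under the projection
  obtain ⟨N, hN, hNeq⟩ := sum_aeval_prj_eq eA eB prj hpX hp1 G hσ₀G hσ₀
  have hS : aeval prj (topComponent w perG) = ((N : ℕ) : ℝ≥0) • perG' := by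
    rw [htopP, map_sum]
    exact hNeq
  obtain ⟨pb, hpb⟩ := exists_pb eA eB
  have hsupp : ∀ m' : (Fin a × Fin a) →₀ ℕ, m' ∈ (aeval prj (topComponent w h)).support ↔
      ∃ m ∈ h.support, (∀ e ∈ m.support, (e.1 ∈ A ↔ e.2 ∈ B)) ∧
        ∀ x y : Fin a, m' (x, y) = m ((eA x : Fin n), (eB y : Fin n)) := by
    intro m'
    rw [mem_support_aeval_prj_iff eA eB pb hpb prj hpX hp1]
    constructor
    · rintro ⟨d, hdT, hd⟩
      obtain ⟨hdh, hbd⟩ := (hsuppT d).1 hdT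
      exact ⟨d, hdh, hbd, (pb_eq_iff eA eB pb hpb d m').1 hd⟩
    · rintro ⟨m, hmh, hbd, hm'⟩
      exact ⟨m, (hsuppT m).2 ⟨hmh, hbd⟩, (pb_eq_iff eA eB pb hpb m m').2 hm'⟩
  -- (3) assemble
  refine ⟨aeval prj (topComponent w h), ?_, hsupp, ?_⟩
  · intro h0
    have hm := (hsupp (pb m₀)).2 ⟨m₀, hm₀, hm₀c, fun x y => hpb m₀ x y⟩
    rw [h0, support_zero] at hm
    exact Finset.notMem_empty _ hm
  · exact complexity_mul_aeval_topComponent_le w prj hpP perG h perG'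
      (Nat.cast_ne_zero.2 hN) hS

end Summit.ValiantsHypothesis.ValiantsHypothesis.Theorems.DivisionGap.PerMultiplesHard.HostBlockParts

end
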